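import Mathlib
import Summits.AtomisticToContinuum.HydrodynamicLimit.Theorems.InformationPercolationEngineKickFairRelEquilibriumMesoConditionThePastDefs
import Summits.AtomisticToContinuum.HydrodynamicLimit.Theorems.InformationPercolationEngineKickFairRelEquilibriumMesoReductionA
import Summits.AtomisticToContinuum.HydrodynamicLimit.Theorems.KickFairRelEquilibriumMeso.Negative.WindowAlgebra
import HarnessLib

/-!
# `KickFairRelEquilibriumMeso` — the strategist's SPLIT glue
# `KickFairRelEquilibriumMeso_of_subs : SingleKickBias rs → TruncatedFluctuation rs → CountExcessLG → KickFairRelEquilibriumMeso`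

Support file (`--supports stmt-AtomisticToContinuum-15177`) for the crux-strategist decomposition (D-0019 glued
split, CRUX-STRATEGIST output (b)) of the rank-2 crux
`Summit.AtomisticToContinuum.HydrodynamicLimit.Theses.InformationPercolationEngine.KickFairRelEquilibriumMeso`
into the three sub-cruxes that are EXACTLY the three open registered stubs of the live line
`Cruxes/KickFairRelEquilibriumMeso/Lines/condition_the_past.lean` (rev 3, lead c7):

* `SingleKickBias rs` (B1) — the `LG`-conditional bias of one kick given its typed past, in Campbell-`L¹`;
  NECESSARY for the crux body along `rs` (`singleKickBias_of_mesoBody`, p150031);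
* `TruncatedFluctuation rs` (TF) — the index-truncated, `LG`-conditionally-centred, past-weighted kick sum is
  small in `L¹(LG)` uniformly over measurable weights; NECESSARY for the crux body along `rs`
  (`truncatedFluctuation_of_mesoBody`);
* `CountExcessLG` (CT-a) — the `LG`-mean excess of per-sphere collision counts over `A (N+1)^{1/3}` (the count debt).

The implication is the composition, by name, of three LANDED theorems: the lead's reduction
`stub_reductionA : SingleKickBias rs → CountExcessLG → TruncatedFluctuation rs → MesoBody rs` (p143726), the
disprover's definitional window algebra `kickFairRelEquilibriumMeso_iff` (p109023) and the admissibility of the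
line's cell sequence `rs N = (N+1)^{-1/4}` (`rs_pos`, `tendsto_rs`, `tendsto_succ_mul_rs_pow_three`, p109029).
It is the sorry-free content of the skeleton theorem `ConditionThePastLine.KickFairRelEquilibriumMeso_of`, stated
over the three stub `Prop`s directly (no `type_of%` indirection), so that the route-level split
`route edit --split KickFairRelEquilibriumMeso --into SingleKickBias TruncatedFluctuation CountExcessLG` has its
glue `C₁ → C₂ → C₃ → C` proved in the tree before it is filed. Hypothesis order = children order of the split.
-/

noncomputable section

open MeasureTheory Set Filter Topology
open scoped ENNReal Classical

namespace Summit.AtomisticToContinuum.HydrodynamicLimit.Theorems.KickFairRelEquilibriumMesoLine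

open Literature.Analysis.FluidPDE Literature.MathematicalPhysics.KineticTheory
open Summit.AtomisticToContinuum.HydrodynamicLimit.Theorems.KickFairRelEquilibriumMesoNegative
  (MesoBody kickFairRelEquilibriumMeso_iff)

/-- **Split glue for the crux `KickFairRelEquilibriumMeso`** (strategist decomposition into the three open
stubs of the line `condition-the-past`): the single-kick conditional bias bound B1, the truncated fluctuation
bound TF and the count excess CT-a, all along the line's admissible cell sequence `rs N = (N+1)^{-1/4}`, imply
the crux BY NAME — `stub_reductionA` gives the body `MesoBody rs`, and the window algebra with the admissibility
of `rs` closes the `∃ rs` prefix. [folklore] -/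
theorem KickFairRelEquilibriumMeso_of_subs :
    SingleKickBias rs → TruncatedFluctuation rs → CountExcessLG →
      Summit.AtomisticToContinuum.HydrodynamicLimit.Theses.InformationPercolationEngine.KickFairRelEquilibriumMeso :=
  fun hB1 hTF hCa =>
    kickFairRelEquilibriumMeso_iff.2
      ⟨rs, rs_pos, tendsto_rs, tendsto_succ_mul_rs_pow_three, stub_reductionA hB1 hCa hTF⟩

end Summit.AtomisticToContinuum.HydrodynamicLimit.Theorems.KickFairRelEquilibriumMesoLine

end
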